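import Summits.CriticalPhenomena.Ising3D.Control2DOpeEpsTail
import Mathlib.Analysis.Normed.Ring.InfiniteSum
import Mathlib.Tactic.Linarith
import Mathlib.Tactic.Positivity
import Mathlib.Tactic.FieldSimp
import Mathlib.Tactic.Ring
import HarnessLib

/-!
# Readout certificates, analytic half: a TWO-SIDED tail bound for the scalar block under the table functional at `(1/2,1/2)`,
for dimensions up to `Δ = 2(1+√2)` (cell `pub-ising3x`, seat controls-1 gen 29; KERNEL PATH, certificate kind "readout" — CONTROL-ONLY)

HONEST FRAMING: lottery ticket; floor = tightest certified 3D Ising CFT bounds; no exact-solution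
claim without a proof. CONTROL-ONLY (`d = 2`); nothing numerical is asserted here.

A READOUT certificate (STRUCTURE.md §5 typing order T-2, `Control2DConjectureCF`: the obligation nodes `CFDipΛ`) compares the
values `φ[F^{s}_-[g_{Δ,0}]]` of a table functional `φ = taylorFunctional2D (1/2) S w` at finitely many dimensions `Δ ∈ [4, 4.66]`.
A kernel replay sees only the TRUNCATED block `Q_N(Δ,0)` (`taylorFunctional2D_half_crossF_QN`: a finite sum of rationals at
rational `Δ`, up to the positive factor `(1/2)^{2s+Δ}`), so it needs a two-sided bound on the dropped double `z`-series tail.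
`Control2DOpeEpsTail.phi_block0_le_QN_add_tail` (controls-1 g21) is the one-sided bound on `0 ≤ Δ ≤ 2`; this file proves the
two-sided bound on `0 ≤ Δ ≤ 6` with `Δ(Δ-4) ≤ 4` (i.e. `h = Δ/2 ≤ 1 + √2`), same architecture:
  `|φ[F_-[g_{Δ,0}]] - φ[F_-[Q_N(Δ,0)]]| ≤ (1/2)^{2s} (1/2)^Δ · 2W · A² · σ (2 S_N + σ)`,
`A = max 1 (Δ/4)` (`a_m(Δ/2) ≤ A`, `chiralCoeff_le_max`), `S_N = Σ_{m<N} 2^{-m} C(m+Λ+4, Λ)` (written out; no new definition),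
`σ = 16 · tailMajor Λ (N+4)`, for `0 ≤ s ≤ 1`, table indices `≤ Λ`, `Λ < N + 5` (`abs_phi_block0_sub_QN_le`). Ingredients: the
pair-monomial bound `abs_taylorFunctional2D_half_pairPow_le_real` with `n_b = m' + 3` (`Δ/2 ≤ 3`), the geometric tail
`tsum_tail_le_tailMajor`, termwise action of `φ` on the block's pair-monomial series (`hasSummableGerms_pairPow`). PROVED; no facts,
standard axioms only. The kernel form (exact rational head + this bound ⇒ comparisons of values) is `Control2DReadoutKernel`.
[cite: RattazziEtAl2008, §5.5]
-/

namespace Summit.CriticalPhenomena.Ising3D.Control2D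

open Finset Set
open Literature.MathematicalPhysics.QuantumFieldTheory.ConformalBootstrap3D

/-! ### `a_m(h) ≤ max 1 (h/2)` up to `h = 1 + √2` -/

/-- `a_m(h) ≤ max 1 (h/2)` for `0 ≤ h` with `h(h-2) ≤ 1`: the first factor of the product form is `h/2`, every other factor
`(h+i)²/((i+1)(2h+i)) ≤ 1 ⇔ h² ≤ 2h + i`, which holds for `i ≥ 1`. [folklore] -/
theorem chiralCoeff_le_max {h : ℝ} (h0 : 0 ≤ h) (hq : h * (h - 2) ≤ 1) (m : ℕ) : chiralCoeff h m ≤ max 1 (h / 2) := by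
  rw [chiralCoeff_eq_prod h0]
  unfold chiralProd
  cases m with
  | zero => simp
  | succ n =>
      rw [Finset.prod_range_succ']
      have hrest : ∏ i ∈ range n, chiralFactor (i + 1) h ≤ 1 := by
        refine Finset.prod_le_one (fun i _ => chiralFactor_nonneg (i + 1) h0) fun i _ => ?_
        unfold chiralFactor
        rw [if_neg (Nat.succ_ne_zero i)]
        have hi1 : (1 : ℝ) ≤ ((i + 1 : ℕ) : ℝ) := by exact_mod_cast Nat.le_add_left 1 i
        rw [div_le_one (by positivity)]
        nlinarith
      have h0' : 0 ≤ ∏ i ∈ range n, chiralFactor (i + 1) h :=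
        Finset.prod_nonneg fun i _ => chiralFactor_nonneg (i + 1) h0
      have hf0 : chiralFactor 0 h = h / 2 := by unfold chiralFactor; rw [if_pos rfl]
      rw [hf0]
      calc (∏ i ∈ range n, chiralFactor (i + 1) h) * (h / 2) ≤ 1 * (h / 2) :=
            mul_le_mul_of_nonneg_right hrest (by linarith)
        _ = h / 2 := one_mul _
        _ ≤ max 1 (h / 2) := le_max_right _ _

/-! ### The two-sided majorant theorem for the scalar block -/

/-- **Two-sided tail bound for the scalar block under the table functional at `(1/2,1/2)`** (`0 ≤ s ≤ 1`, table indices `≤ Λ`,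
`0 ≤ Δ ≤ 6`, `Δ(Δ-4) ≤ 4`, `Λ < N + 5`): with `A = max 1 (Δ/4)`, `σ = 16 · tailMajor Λ (N+4)`,
`|φ[F_-[g_{Δ,0}]] - φ[F_-[Q_N(Δ,0)]]| ≤ (1/2)^{2s} (1/2)^Δ · 2W · A² · σ (2 S_N + σ)` (`S_N = Σ_{m<N} 2^{-m} C(m+Λ+4, Λ)`, written out).
PROVED. [cite: RattazziEtAl2008, §5.5] -/
theorem abs_phi_block0_sub_QN_le (S : Finset (ℕ × ℕ)) (w : ℕ × ℕ → ℝ) {s : ℝ} (hs0 : 0 ≤ s) (hs1 : s ≤ 1)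
    {Λ : ℕ} (hΛ : ∀ p ∈ S, p.1 ≤ Λ ∧ p.2 ≤ Λ) {Δ : ℝ} (hΔ0 : 0 ≤ Δ) (hΔ6 : Δ ≤ 6) (hΔq : Δ * (Δ - 4) ≤ 4)
    {N : ℕ} (hN : Λ < N + 5) :
    |taylorFunctional2D (1 / 2) S w (crossF s (-1) (globalBlock Δ 0)) -
        taylorFunctional2D (1 / 2) S w (crossF s (-1) (QN N 0 Δ))| ≤
      (1 / 2 : ℝ) ^ s * (1 / 2 : ℝ) ^ s * (1 / 2 : ℝ) ^ Δ * (2 * absWeight S w) * (max 1 (Δ / 4)) ^ 2 *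
        ((16 * tailMajor Λ (N + 4)) *
          (2 * (∑ m ∈ range N, (1 / 2 : ℝ) ^ m * (((m + Λ + 4).choose Λ : ℕ) : ℝ)) + 16 * tailMajor Λ (N + 4))) := by
  have hφ := isTaylorFunctional_taylorFunctional2D (1 / 2) S w
  set HM : ℝ := ∑ m ∈ range N, (1 / 2 : ℝ) ^ m * (((m + Λ + 4).choose Λ : ℕ) : ℝ) with hHM
  have hx0 : (0 : ℝ) < 1 / 2 := by norm_num
  have hx1 : (1 / 2 : ℝ) < 1 := by norm_num
  have hΔℓ : ((0 : ℕ) : ℝ) ≤ Δ := by simpa using hΔ0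
  have hρ0 : (0 : ℝ) < 1 / 2 * (1 - 1 / 2) / 2 := by norm_num
  have hρ : (1 / 2 : ℝ) * (1 - 1 / 2) / 2 < 1 / 2 * (1 - 1 / 2) := by norm_num
  have hs := hφ.hasSum_mul_of_hasSummableGerms hρ0 (hasSummableGerms_pairPow hΔℓ s hx0 hx1 hρ0 hρ)
    (crossF s (-1) (globalBlock Δ 0)) (fun h' k hh hk =>
      hasSum_crossF_globalBlock hΔℓ (mem_Ioo_of_abs_lt (hh.trans hρ)) (mem_Ioo_of_abs_lt (hk.trans hρ)))
  have hh : (Δ + ((0 : ℕ) : ℝ)) / 2 = Δ / 2 := by simp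
  have hh' : (Δ - ((0 : ℕ) : ℝ)) / 2 = Δ / 2 := by simp
  simp only [hh, hh'] at hs
  set φ' := taylorFunctional2D (1 / 2) S w with hφ'
  set F : ℕ × ℕ → ℝ := fun mm => chiralCoeff (Δ / 2) mm.1 * chiralCoeff (Δ / 2) mm.2 *
    φ' (crossF s (-1) (pairPow (Δ / 2 + (mm.1 : ℝ)) (Δ / 2 + (mm.2 : ℝ)))) with hF
  have hsF : HasSum F (φ' (crossF s (-1) (globalBlock Δ 0))) := hs
  set A : ℝ := max 1 (Δ / 4) with hA
  set C0 : ℝ := (1 / 2 : ℝ) ^ s * (1 / 2 : ℝ) ^ s with hC0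
  set K : ℝ := C0 * (1 / 2 : ℝ) ^ Δ * (2 * absWeight S w) * A ^ 2 with hK
  set t : ℕ → ℝ := fun m => (1 / 2 : ℝ) ^ m * (((m + Λ + 4).choose Λ : ℕ) : ℝ) with ht
  have hA1 : 1 ≤ A := le_max_left _ _
  have hA0 : 0 ≤ A := zero_le_one.trans hA1
  have hC0nn : 0 ≤ C0 := by rw [hC0]; positivity
  have hDpos : 0 < (1 / 2 : ℝ) ^ Δ := Real.rpow_pos_of_pos (by norm_num) _
  have hKnn : 0 ≤ K := by rw [hK]; have := absWeight_nonneg S w; positivity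
  have ht0 : ∀ m, 0 ≤ t m := fun m => by rw [ht]; positivity
  have hh0 : 0 ≤ Δ / 2 := by linarith
  have hh3 : Δ / 2 ≤ 3 := by linarith
  have hhq : Δ / 2 * (Δ / 2 - 2) ≤ 1 := by nlinarith
  have haA : ∀ m, chiralCoeff (Δ / 2) m ≤ A := fun m =>
    (chiralCoeff_le_max hh0 hhq m).trans (by rw [hA, show Δ / 2 / 2 = Δ / 4 by ring])
  -- (1) termwise bound `|F (m,m')| ≤ K t_m t_{m'}`
  have hbound : ∀ mm : ℕ × ℕ, |F mm| ≤ K * (t mm.1 * t mm.2) := by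
    intro mm
    obtain ⟨m, m'⟩ := mm
    have ha : 0 ≤ chiralCoeff (Δ / 2) m * chiralCoeff (Δ / 2) m' :=
      mul_nonneg (chiralCoeff_nonneg hh0 _) (chiralCoeff_nonneg hh0 _)
    have haA2 : chiralCoeff (Δ / 2) m * chiralCoeff (Δ / 2) m' ≤ A ^ 2 := by
      rw [sq]
      exact mul_le_mul (haA m) (haA m') (chiralCoeff_nonneg hh0 _) hA0
    -- the pair monomial in the form `pairPow (b + J) b`, `b = Δ/2 + min`, `J = |m - m'|`, with `n_b = min + 3`
    have hval : |φ' (crossF s (-1) (pairPow (Δ / 2 + (m : ℝ)) (Δ / 2 + (m' : ℝ))))| ≤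
        C0 * (1 / 2 : ℝ) ^ Δ * (2 * absWeight S w) * (t m * t m') := by
      rcases le_total m' m with hle | hle
      · obtain ⟨J, rfl⟩ := Nat.exists_eq_add_of_le hle
        have hb : 0 ≤ Δ / 2 + (m' : ℝ) := by positivity
        have hbn : Δ / 2 + (m' : ℝ) ≤ ((m' + 3 : ℕ) : ℝ) := by push_cast; linarith
        have hv := abs_taylorFunctional2D_half_pairPow_le_real S w hs0 hs1 hΛ hb hbn J
        have e1 : Δ / 2 + (m' : ℝ) + (J : ℝ) = Δ / 2 + ((m' + J : ℕ) : ℝ) := by push_cast; ring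
        rw [e1] at hv
        refine hv.trans (le_of_eq ?_)
        have e2 : (1 / 2 : ℝ) ^ (Δ / 2 + ((m' + J : ℕ) : ℝ)) * (1 / 2 : ℝ) ^ (Δ / 2 + (m' : ℝ)) =
            (1 / 2 : ℝ) ^ Δ * ((1 / 2 : ℝ) ^ (m' + J) * (1 / 2 : ℝ) ^ m') := by
          rw [Real.rpow_add_natCast (by norm_num), Real.rpow_add_natCast (by norm_num), ← Real.rpow_natCast,
            ← Real.rpow_natCast]
          have : (1 / 2 : ℝ) ^ Δ = (1 / 2 : ℝ) ^ (Δ / 2) * (1 / 2 : ℝ) ^ (Δ / 2) := by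
            rw [← Real.rpow_add (by norm_num)]; ring_nf
          rw [this]; ring
        rw [hC0, ht]
        simp only
        rw [show m' + 3 + J + Λ + 1 = m' + J + Λ + 4 by ring, show m' + 3 + Λ + 1 = m' + Λ + 4 by ring]
        calc (1 / 2 : ℝ) ^ s * (1 / 2 : ℝ) ^ s * (1 / 2 : ℝ) ^ (Δ / 2 + ((m' + J : ℕ) : ℝ)) * (1 / 2 : ℝ) ^ (Δ / 2 + (m' : ℝ)) *
              (2 * (((m' + J + Λ + 4).choose Λ : ℕ) : ℝ) * (((m' + Λ + 4).choose Λ : ℕ) : ℝ) * absWeight S w)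
            = (1 / 2 : ℝ) ^ s * (1 / 2 : ℝ) ^ s * ((1 / 2 : ℝ) ^ (Δ / 2 + ((m' + J : ℕ) : ℝ)) * (1 / 2 : ℝ) ^ (Δ / 2 + (m' : ℝ))) *
              (2 * (((m' + J + Λ + 4).choose Λ : ℕ) : ℝ) * (((m' + Λ + 4).choose Λ : ℕ) : ℝ) * absWeight S w) := by ring
          _ = _ := by rw [e2]; ring
      · obtain ⟨J, rfl⟩ := Nat.exists_eq_add_of_le hle
        have hb : 0 ≤ Δ / 2 + (m : ℝ) := by positivity
        have hbn : Δ / 2 + (m : ℝ) ≤ ((m + 3 : ℕ) : ℝ) := by push_cast; linarith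
        have hv := abs_taylorFunctional2D_half_pairPow_le_real S w hs0 hs1 hΛ hb hbn J
        have e1 : Δ / 2 + (m : ℝ) + (J : ℝ) = Δ / 2 + ((m + J : ℕ) : ℝ) := by push_cast; ring
        rw [e1] at hv
        rw [show pairPow (Δ / 2 + (m : ℝ)) (Δ / 2 + ((m + J : ℕ) : ℝ)) = pairPow (Δ / 2 + ((m + J : ℕ) : ℝ)) (Δ / 2 + (m : ℝ)) from
          funext fun z => funext fun zb => pairPow_comm _ _ z zb]
        refine hv.trans (le_of_eq ?_)
        have e2 : (1 / 2 : ℝ) ^ (Δ / 2 + ((m + J : ℕ) : ℝ)) * (1 / 2 : ℝ) ^ (Δ / 2 + (m : ℝ)) =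
            (1 / 2 : ℝ) ^ Δ * ((1 / 2 : ℝ) ^ (m + J) * (1 / 2 : ℝ) ^ m) := by
          rw [Real.rpow_add_natCast (by norm_num), Real.rpow_add_natCast (by norm_num), ← Real.rpow_natCast,
            ← Real.rpow_natCast]
          have : (1 / 2 : ℝ) ^ Δ = (1 / 2 : ℝ) ^ (Δ / 2) * (1 / 2 : ℝ) ^ (Δ / 2) := by
            rw [← Real.rpow_add (by norm_num)]; ring_nf
          rw [this]; ring
        rw [hC0, ht]
        simp only
        rw [show m + 3 + J + Λ + 1 = m + J + Λ + 4 by ring, show m + 3 + Λ + 1 = m + Λ + 4 by ring]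
        calc (1 / 2 : ℝ) ^ s * (1 / 2 : ℝ) ^ s * (1 / 2 : ℝ) ^ (Δ / 2 + ((m + J : ℕ) : ℝ)) * (1 / 2 : ℝ) ^ (Δ / 2 + (m : ℝ)) *
              (2 * (((m + J + Λ + 4).choose Λ : ℕ) : ℝ) * (((m + Λ + 4).choose Λ : ℕ) : ℝ) * absWeight S w)
            = (1 / 2 : ℝ) ^ s * (1 / 2 : ℝ) ^ s * ((1 / 2 : ℝ) ^ (Δ / 2 + ((m + J : ℕ) : ℝ)) * (1 / 2 : ℝ) ^ (Δ / 2 + (m : ℝ))) *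
              (2 * (((m + J + Λ + 4).choose Λ : ℕ) : ℝ) * (((m + Λ + 4).choose Λ : ℕ) : ℝ) * absWeight S w) := by ring
          _ = _ := by rw [e2]; ring
    have hKt : 0 ≤ C0 * (1 / 2 : ℝ) ^ Δ * (2 * absWeight S w) * (t m * t m') := by
      have := ht0 m; have := ht0 m'; have := absWeight_nonneg S w; positivity
    calc |F (m, m')| = chiralCoeff (Δ / 2) m * chiralCoeff (Δ / 2) m' *
          |φ' (crossF s (-1) (pairPow (Δ / 2 + (m : ℝ)) (Δ / 2 + (m' : ℝ))))| := by
            simp only [hF]; rw [abs_mul, abs_of_nonneg ha]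
      _ ≤ chiralCoeff (Δ / 2) m * chiralCoeff (Δ / 2) m' * (C0 * (1 / 2 : ℝ) ^ Δ * (2 * absWeight S w) * (t m * t m')) :=
          mul_le_mul_of_nonneg_left hval ha
      _ ≤ A ^ 2 * (C0 * (1 / 2 : ℝ) ^ Δ * (2 * absWeight S w) * (t m * t m')) := mul_le_mul_of_nonneg_right haA2 hKt
      _ = K * (t m * t m') := by rw [hK]; ring
  -- (2) the majorant family is summable with sum `K S²`, `S = Σ t`
  obtain ⟨hts, htail⟩ := tsum_tail_le_tailMajor (Λ := Λ) (M := N + 4) (by omega)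
  have hshift : ∀ j : ℕ, t (j + N) = 16 * ((1 / 2 : ℝ) ^ (j + (N + 4)) * ((j + (N + 4) + Λ).choose Λ : ℝ)) := by
    intro j
    rw [ht]
    simp only
    rw [show j + (N + 4) = (j + N) + 4 by ring, pow_add, show j + N + 4 + Λ = j + N + Λ + 4 by ring]
    norm_num
    ring
  have htN : Summable fun j : ℕ => t (j + N) := by
    have := hts.mul_left 16
    refine this.congr fun j => ?_
    rw [hshift]
  have htsum : Summable t := (summable_nat_add_iff N).mp htN
  set Ssum : ℝ := ∑' m, t m with hS
  have hSN : Ssum = HM + ∑' j, t (j + N) := by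
    rw [hS, hHM, ← Summable.sum_add_tsum_nat_add N htsum]
  have hTle : ∑' j, t (j + N) ≤ 16 * tailMajor Λ (N + 4) := by
    calc ∑' j, t (j + N) = ∑' j, 16 * ((1 / 2 : ℝ) ^ (j + (N + 4)) * ((j + (N + 4) + Λ).choose Λ : ℝ)) :=
          tsum_congr hshift
      _ = 16 * ∑' j, (1 / 2 : ℝ) ^ (j + (N + 4)) * ((j + (N + 4) + Λ).choose Λ : ℝ) := tsum_mul_left
      _ ≤ 16 * tailMajor Λ (N + 4) := by linarith [htail]
  have hT0 : 0 ≤ ∑' j, t (j + N) := tsum_nonneg fun j => ht0 _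
  have hH0 : 0 ≤ HM := by rw [hHM]; exact Finset.sum_nonneg fun m _ => ht0 m
  have hG : HasSum (fun mm : ℕ × ℕ => K * (t mm.1 * t mm.2)) (K * (Ssum * Ssum)) := by
    have h1 := htsum.hasSum.mul htsum.hasSum (htsum.mul_of_nonneg htsum ht0 ht0)
    exact h1.mul_left K
  -- (3) kept square = `φ[Q_N]` for `F`, `K S_N²` for the majorant
  set R : Finset (ℕ × ℕ) := range N ×ˢ range N with hR
  have hQ : ∑ mm ∈ R, F mm = φ' (crossF s (-1) (QN N 0 Δ)) := by
    have hT := TN_eq_phi_QN φ' s N 0 Δ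
    simp only [hh, hh'] at hT
    rw [← hT, hR, Finset.sum_product]
  have hRG : ∑ mm ∈ R, K * (t mm.1 * t mm.2) = K * (HM * HM) := by
    rw [hR, ← Finset.mul_sum, Finset.sum_product, hHM, Finset.sum_mul_sum]
  -- (4) compare the complements, both signs
  have hFc : HasSum (fun x : {x // x ∉ R} => F x) (φ' (crossF s (-1) (globalBlock Δ 0)) - ∑ mm ∈ R, F mm) :=
    (Finset.hasSum_iff_compl R).mp hsF
  have hFcn : HasSum (fun x : {x // x ∉ R} => -F x) (-(φ' (crossF s (-1) (globalBlock Δ 0)) - ∑ mm ∈ R, F mm)) :=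
    hFc.neg
  have hGc : HasSum (fun x : {x // x ∉ R} => K * (t x.1.1 * t x.1.2))
      (K * (Ssum * Ssum) - ∑ mm ∈ R, K * (t mm.1 * t mm.2)) :=
    (Finset.hasSum_iff_compl R).mp hG
  have hcmp := hasSum_le (fun x : {x // x ∉ R} => (le_abs_self _).trans (hbound x.1)) hFc hGc
  have hcmpn := hasSum_le (fun x : {x // x ∉ R} => (neg_le_abs _).trans (hbound x.1)) hFcn hGc
  rw [hQ, hRG] at hcmp hcmpn
  -- (5) `S² - S_N² ≤ σ(2 S_N + σ)`
  have hsq : Ssum * Ssum - HM * HM ≤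
      (16 * tailMajor Λ (N + 4)) * (2 * HM + 16 * tailMajor Λ (N + 4)) := by
    rw [hSN]
    nlinarith [hTle, hT0, hH0]
  have hfin : K * (Ssum * Ssum) - K * (HM * HM) ≤
      K * ((16 * tailMajor Λ (N + 4)) * (2 * HM + 16 * tailMajor Λ (N + 4))) := by
    rw [← mul_sub]; exact mul_le_mul_of_nonneg_left hsq hKnn
  have h1 : φ' (crossF s (-1) (globalBlock Δ 0)) - φ' (crossF s (-1) (QN N 0 Δ)) ≤
      K * ((16 * tailMajor Λ (N + 4)) * (2 * HM + 16 * tailMajor Λ (N + 4))) := hcmp.trans hfin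
  have h2 : -(φ' (crossF s (-1) (globalBlock Δ 0)) - φ' (crossF s (-1) (QN N 0 Δ))) ≤
      K * ((16 * tailMajor Λ (N + 4)) * (2 * HM + 16 * tailMajor Λ (N + 4))) := by
    have := hcmpn.trans hfin; linarith
  rw [hK, hC0] at h1 h2
  exact abs_le.mpr ⟨by linarith, by linarith⟩

end Summit.CriticalPhenomena.Ising3D.Control2D
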